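import Literature.IUT.HodgeTheaters.PuncturedEllipticCoveringsCharacteristic
import HarnessLib

/-!
# [IUTchI] Corollary 1.2 from core-level isomorphisms `Π_C ⥲ Π'_C` — proof-only companion

Mochizuki, *Inter-universal Teichmüller theory I*, kurims manuscript (May 2020), §1, Corollary 1.2
p. 39 and Remark 1.2.1 p. 40 ([IUTchI] Cor 1.2 p.39) [claim: Mochizuki2012, status: disputed].
`PuncturedEllipticCoveringsCharacteristic.lean` (seat abc-iut-L5-d4) derives the typed
`CharacteristicNatureOfCoverings D D'` from `ArrowCoveringClaims` and the anabelian inputs phrased at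
the level of `Π_C̲` (an extension `Φ : Π_C̲ ⥲ Π'_C̲` of the given isomorphism).  The printed proof
obtains its extension one level higher — on the `k`-CORES: "`C` is a `k`-core of `X→`, `C→`", so an
isomorphism `Π_{X→} ⥲ Π'_{X→}` extends to `Θ : Π_C ⥲ Π'_C` (Remark 1.2.1: `Aut_k(X→) = Gal(X→/C̲)`),
and `Π_C̲` is then recovered inside `Π_C` as the normaliser of `Π_{X→}` (resp. `Π_{C→}`).  This file
provides that SOCKET (discharged here by the equivalent uniqueness-of-index / normaliser-transport
arguments of the companion): `characteristicNatureOfCoverings_of_core_isos` — the typed Corollary 1.2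
from `ArrowCoveringClaims`, `Rmk121` (both data) and, as hypotheses, (hX)/(hC): every bicontinuous
`φ : Π_{X→} ⥲ Π'_{X→}` (resp. `ψ : Π_{C→} ⥲ Π'_{C→}`) extends to a continuous `Θ : Π_C ⥲ Π'_C` carrying
the cusp classes (pushed into `Π_C`) onto their counterparts.  Plumbing: `Rmk121.map_piCbar_eq_of_piCarrow`
(normaliser transport for `Π_{C→}`), `image_map_subtype_transport` (cusp classes through a restriction),
`continuous_restrict` / `exists_continuous_restrict_piCbar`.  No new definitions; the anabelian
extension property is NEVER asserted; no side taken on [IUTchIII] Cor. 3.12.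
-/

namespace Literature.IUT.HodgeTheaters

namespace PuncturedEllipticData

open Topology Literature.AnabelianGeometry.AbsoluteAnabelian

universe u

variable {D D' : PuncturedEllipticData.{u}}

/-- **Remark 1.2.1 ⇒ `Π_C̲` is characteristic for `Π_{C→} ⊆ Π_C`**: if `N_{Π_C}(Π_{C→}) = Π_C̲` holds
for `D` and `D'`, any `Θ : Π_C ⥲ Π'_C` with `Θ(Π_{C→}) = Π'_{C→}` satisfies `Θ(Π_C̲) = Π'_C̲`.
([IUTchI] Rmk 1.2.1 p.40) [claim: Mochizuki2012, status: disputed] -/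
theorem Rmk121.map_piCbar_eq_of_piCarrow (h : D.Rmk121) (h' : D'.Rmk121) (Θ : D.PiC ≃* D'.PiC)
    (hΘ : D.piCarrow.map Θ.toMonoidHom = D'.piCarrow) :
    D.PiCbar.map Θ.toMonoidHom = D'.PiCbar := by
  rw [← h.normalizer_piCarrow, ← h'.normalizer_piCarrow, Subgroup.map_equiv_normalizer_eq, hΘ]

/-- An isomorphism `Θ : Π_C ⥲ Π'_C` EXTENDING `φ : A ⥲ A'` (subgroups `A ≤ Π_C`, `A' ≤ Π'_C`) carries
`A` onto `A'`. ([IUTchI] Cor 1.2 p.39) [claim: Mochizuki2012, status: disputed] -/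
theorem map_eq_of_extends {A : Subgroup D.PiC} {A' : Subgroup D'.PiC} (φ : A ≃* A')
    (Θ : D.PiC ≃* D'.PiC) (hext : ∀ x : A, Θ (x : D.PiC) = (φ x : D'.PiC)) :
    A.map Θ.toMonoidHom = A' := by
  ext y
  simp only [Subgroup.mem_map, MulEquiv.coe_toMonoidHom]
  constructor
  · rintro ⟨x, hx, rfl⟩
    rw [hext ⟨x, hx⟩]
    exact (φ ⟨x, hx⟩).2
  · intro hy
    refine ⟨(φ.symm ⟨y, hy⟩ : D.PiC), (φ.symm ⟨y, hy⟩).2, ?_⟩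
    rw [hext, MulEquiv.apply_symm_apply]

/-- The restriction `Π_C̲ ⥲ Π'_C̲` of a CONTINUOUS `Θ : Π_C ⥲ Π'_C` with `Θ(Π_C̲) = Π'_C̲` is continuous
(as an existence statement: some restriction agreeing with `Θ` is continuous).
([IUTchI] Cor 1.2 p.39) [claim: Mochizuki2012, status: disputed] -/
theorem exists_continuous_restrict_piCbar (Θ : D.PiC ≃* D'.PiC) (hΘc : Continuous Θ)
    (hΘ : D.PiCbar.map Θ.toMonoidHom = D'.PiCbar) :
    ∃ Φ : D.PiCbar ≃* D'.PiCbar, Continuous Φ ∧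
      ∀ x : D.PiCbar, ((Φ x : D'.PiCbar) : D'.PiC) = Θ (x : D.PiC) := by
  obtain ⟨Φ, hΦ⟩ := exists_restrict_piCbar Θ hΘ
  refine ⟨Φ, ?_, hΦ⟩
  have hfun : (fun x : D.PiCbar => ((Φ x : D'.PiCbar) : D'.PiC)) = fun x : D.PiCbar => Θ (x : D.PiC) :=
    funext hΦ
  have hc : Continuous fun x : D.PiCbar => ((Φ x : D'.PiCbar) : D'.PiC) := by
    rw [hfun]
    exact hΘc.comp continuous_subtype_val
  exact continuous_induced_rng.2 hc

/-- Transport of a class of subgroups of `Π_C̲` through a restriction: if `Φ : Π_C̲ ⥲ Π'_C̲` restricts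
`Θ : Π_C ⥲ Π'_C` and `Θ` carries the class `S` (pushed into `Π_C`) onto the class `S'` (pushed into
`Π'_C`), then `Φ` carries `S` onto `S'`. ([IUTchI] Cor 1.2 p.39) [claim: Mochizuki2012, status: disputed] -/
theorem image_map_subtype_transport (Θ : D.PiC ≃* D'.PiC) (Φ : D.PiCbar ≃* D'.PiCbar)
    (hΦ : ∀ x : D.PiCbar, ((Φ x : D'.PiCbar) : D'.PiC) = Θ (x : D.PiC))
    (S : Set (Subgroup D.PiCbar)) (S' : Set (Subgroup D'.PiCbar))
    (hS : (fun K => (K.map D.PiCbar.subtype).map Θ.toMonoidHom) '' S =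
      (fun K' => K'.map D'.PiCbar.subtype) '' S') :
    Subgroup.map Φ.toMonoidHom '' S = S' := by
  -- the key identity: pushing `Φ(K)` into `Π'_C` is `Θ` applied to `K` pushed into `Π_C`
  have key : ∀ K : Subgroup D.PiCbar,
      (K.map Φ.toMonoidHom).map D'.PiCbar.subtype = (K.map D.PiCbar.subtype).map Θ.toMonoidHom := by
    intro K
    ext y
    simp only [Subgroup.mem_map, MulEquiv.coe_toMonoidHom, Subgroup.coe_subtype, exists_exists_and_eq_and]
    constructor
    · rintro ⟨x, hx, rfl⟩
      exact ⟨x, hx, (hΦ x).symm⟩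
    · rintro ⟨x, hx, rfl⟩
      exact ⟨x, hx, hΦ x⟩
  have hinj : Function.Injective fun K' : Subgroup D'.PiCbar => K'.map D'.PiCbar.subtype :=
    Subgroup.map_injective D'.PiCbar.subtype_injective
  apply Set.Subset.antisymm
  · rintro _ ⟨K, hK, rfl⟩
    have hmem : (K.map D.PiCbar.subtype).map Θ.toMonoidHom ∈
        (fun K' => K'.map D'.PiCbar.subtype) '' S' := by
      rw [← hS]
      exact ⟨K, hK, rfl⟩
    obtain ⟨K', hK', hKK'⟩ := hmem
    have : K' = K.map Φ.toMonoidHom := hinj (by rw [hKK', ← key])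
    rw [← this]
    exact hK'
  · intro K' hK'
    have hmem : K'.map D'.PiCbar.subtype ∈
        (fun K => (K.map D.PiCbar.subtype).map Θ.toMonoidHom) '' S := by
      rw [hS]
      exact ⟨K', hK', rfl⟩
    obtain ⟨K, hK, hKK'⟩ := hmem
    refine ⟨K, hK, hinj ?_⟩
    show (K.map Φ.toMonoidHom).map D'.PiCbar.subtype = K'.map D'.PiCbar.subtype
    rw [key]
    exact hKK'

/-- **Corollary 1.2 from isomorphisms of the `k`-cores.**  For data `D`, `D'` satisfying the printed
claims of pp. 37–38 (`ArrowCoveringClaims`) and Remark 1.2.1 (`Rmk121`: `Π_C̲ = N(Π_{X→}) = N(Π_{C→})`),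
the typed Corollary 1.2 holds AS SOON AS: (hX) every bicontinuous `φ : Π_{X→} ⥲ Π'_{X→}` extends to a
continuous `Θ : Π_C ⥲ Π'_C` ["`C` is a `k`-core of `X→`"] carrying the classes of decomposition groups
of `{ε′, ε″}` and of `ε̲` onto their counterparts [[AbsTopI] Lem. 4.5, [AbsAnab] Lem. 1.3.9 as amended
by Rmk. 1.2.2], and (hC) likewise for `ψ : Π_{C→} ⥲ Π'_{C→}` and the class of `ε̲` — hypotheses,
never asserted.  The restriction to `Π_C̲ = N(Π_{X→})` and the clauses `Φ(Π_X̲) = Π'_X̲`,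
`Φ(Π_{C→}) = Π'_{C→}` are then the companion's group theory.
([IUTchI] Cor 1.2 p.39) [claim: Mochizuki2012, status: disputed] -/
theorem characteristicNatureOfCoverings_of_core_isos (h : D.ArrowCoveringClaims)
    (h' : D'.ArrowCoveringClaims) (hR : D.Rmk121) (hR' : D'.Rmk121)
    (hX : ∀ φ : D.piXarrow ≃* D'.piXarrow, Continuous φ → Continuous φ.symm →
      ∃ Θ : D.PiC ≃* D'.PiC, Continuous Θ ∧ (∀ x : D.piXarrow, Θ (x : D.PiC) = (φ x : D'.PiC)) ∧
        (fun K => (K.map D.PiCbar.subtype).map Θ.toMonoidHom) '' D.cuspClassX =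
          (fun K' => K'.map D'.PiCbar.subtype) '' D'.cuspClassX ∧
        (fun K => (K.map D.PiCbar.subtype).map Θ.toMonoidHom) '' D.cuspClassC =
          (fun K' => K'.map D'.PiCbar.subtype) '' D'.cuspClassC)
    (hC : ∀ ψ : D.piCarrow ≃* D'.piCarrow, Continuous ψ → Continuous ψ.symm →
      ∃ Θ : D.PiC ≃* D'.PiC, Continuous Θ ∧ (∀ x : D.piCarrow, Θ (x : D.PiC) = (ψ x : D'.PiC)) ∧
        (fun K => (K.map D.PiCbar.subtype).map Θ.toMonoidHom) '' D.cuspClassC =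
          (fun K' => K'.map D'.PiCbar.subtype) '' D'.cuspClassC) :
    D.CharacteristicNatureOfCoverings D' := by
  refine characteristicNatureOfCoverings_of_core_extensions h h' (fun φ hφ hφ' => ?_)
    (fun ψ hψ hψ' => ?_)
  · obtain ⟨Θ, hΘc, hext, hcX, hcC⟩ := hX φ hφ hφ'
    have hA : D.piXarrow.map Θ.toMonoidHom = D'.piXarrow := map_eq_of_extends φ Θ hext
    have hCb : D.PiCbar.map Θ.toMonoidHom = D'.PiCbar := hR.map_piCbar_eq hR' Θ hA
    obtain ⟨Φ, hΦc, hΦ⟩ := exists_continuous_restrict_piCbar Θ hΘc hCb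
    refine ⟨Φ, hΦc, fun x hx hx' => ?_, image_map_subtype_transport Θ Φ hΦ _ _ hcX,
      image_map_subtype_transport Θ Φ hΦ _ _ hcC⟩
    rw [hΦ ⟨x, hx'⟩]
    exact hext ⟨x, hx⟩
  · obtain ⟨Θ, hΘc, hext, hcC⟩ := hC ψ hψ hψ'
    have hP : D.piCarrow.map Θ.toMonoidHom = D'.piCarrow := map_eq_of_extends ψ Θ hext
    have hCb : D.PiCbar.map Θ.toMonoidHom = D'.PiCbar := hR.map_piCbar_eq_of_piCarrow hR' Θ hP
    obtain ⟨Φ, hΦc, hΦ⟩ := exists_continuous_restrict_piCbar Θ hΘc hCb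
    refine ⟨Φ, hΦc, fun x hx hx' => ?_, image_map_subtype_transport Θ Φ hΦ _ _ hcC⟩
    rw [hΦ ⟨x, hx'⟩]
    exact hext ⟨x, hx⟩

end PuncturedEllipticData

end Literature.IUT.HodgeTheaters
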